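import Literature.AlgebraicGeometry.Deformation.CanonicalRestrictedLiftGluingQuot
import HarnessLib

/-!
# Canonical restricted lifts, III: the canonical lift of a canonical lift ([Hartshorne2010] proof of Thm. 10.2 (a); [Oort1971] Lemma (2.2.4))

Layer `Literature/AlgebraicGeometry/Deformation`, namespace `Literature.AlgebraicGeometry.Deformation.CanonicalLiftQuot` (continued).
DEFINITION FILE (one construction `liftOfLiftEquiv` + its API; no instance, no notation, no named fact, no `sorry`).  Quotient-currency (U) organ
(cell `hodgecm-mathlib`, P6 sub-desk P6b; count-neutral), sequel of ★ (U-can) I∕II `CanonicalRestrictedLift{,Gluing}Quot`, written for the (vii-e)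
«ATLAS REFINEMENT» head (`SmoothLiftAtlasRefinementQuot`): on a refined atlas the charts ARE canonical restricted lifts `L(r, g)`, so every deeper
chart ring is a canonical lift OF a canonical lift, `L(red_{r,g}, g₂)`, which is not the vocabulary's `L(r, g₂ ∘ g)` on the nose — but canonically
isomorphic to it over `L(r, g)`.

THE POINT.  `L(r, g₂ ∘ g)` is the localisation of `L(r, g)` at the image of `liftSubmonoid r (g₂ ∘ g)` (★ II `isLocalization_map_restrict`);
`L(red_{r,g}, g₂)` is by definition its localisation at `liftSubmonoid (red_{r,g}) g₂ ⊇` that image; and every element of the larger submonoid is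
already a unit in `L(r, g₂ ∘ g)` (`p/m` with `g₂ (g (r p))` a unit — no nilpotents needed), so Mathlib `IsLocalization.of_le` +
`IsLocalization.algEquiv` give THE isomorphism over `L(r, g)`, unique, compatible with reductions and with further restriction.

* `isUnit_restrict_of_mem_liftSubmonoid_reduction`, `isLocalization_restrict_liftSubmonoid_reduction` — the two inputs of `IsLocalization.of_le`;
* `liftOfLiftEquiv : L(red_{r,g}, g₂) ≃ₐ[A'] L(r, g₂ ∘ g)` with `liftOfLiftEquiv_algebraMap`, `liftOfLiftEquiv_symm_restrict`, `liftOfLiftEquiv_unique`,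
  `reduction_liftOfLiftEquiv`, `restrict_liftOfLiftEquiv`.

HC_CM is proved only modulo the printed citations until rung 0 closes; nothing here bears on a summit statement.

## References
* [Hartshorne2010] R. Hartshorne, *Deformation Theory*, GTM 257, Springer (2010): Thm. 10.2 (a) and its proof (p. 81).
* [Oort1971] F. Oort, *Finite group schemes, local moduli for abelian varieties, and lifting problems*, Compositio Math. 23 (1971),
  Lemma (2.2.4) (p. 274).
* [StacksProject] The Stacks Project, Tag 00CP (localisation of localisations).
-/

noncomputable section

universe u

namespace Literature.AlgebraicGeometry.Deformation.CanonicalLiftQuot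

open Literature.AlgebraicGeometry.Deformation.LiftLocalizationQuot Literature.AlgebraicGeometry.Deformation.LiftGluingSuppliersQuot

section LiftOfLift

variable {A' : Type u} [CommRing A'] {P : Type u} [CommRing P] [Algebra A' P] {Q : Type u} [CommRing Q] [Algebra A' Q]
  {Q' : Type u} [CommRing Q'] [Algebra A' Q'] {Q'' : Type u} [CommRing Q''] {Q''' : Type u} [CommRing Q''']
  (r : P →ₐ[A'] Q) (g : Q →+* Q') (hg : ∀ a, g (algebraMap A' Q a) = algebraMap A' Q' a)
  (g₂ : Q' →+* Q'') (g'' : Q →+* Q'') (h : ∀ q, g'' q = g₂ (g q))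

/-- Every element of `liftSubmonoid (red_{r,g}) g₂ ⊆ L(r, g)` becomes a unit in `L(r, g₂ ∘ g)` under the canonical restriction (its reduction is a
unit after `g₂`; units lift along the nilpotent-free bookkeeping of (U-can): `p/m` with `g₂ (g (r p))` a unit).
[cite: StacksProject, Tag 00CP] [cite: Hartshorne2010, Thm. 10.2 (a) (proof), p. 81] -/
theorem isUnit_restrict_of_mem_liftSubmonoid_reduction (x : CanonicalLift r g) (hx : x ∈ liftSubmonoid (reduction r g hg) g₂) :
    IsUnit (restrict r g g'' (liftSubmonoid_mono r g g'' g₂ h) x) := by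
  obtain ⟨p, m, rfl⟩ := IsLocalization.exists_mk'_eq (liftSubmonoid r g) x
  rw [mem_liftSubmonoid_iff] at hx
  have hm : IsUnit (g'' (r m)) := by
    rw [h]
    exact ((mem_liftSubmonoid_iff r g (m : P)).mp m.2).map g₂
  have hp : IsUnit (g'' (r p)) := by
    have e : reduction r g hg (IsLocalization.mk' _ p m) * reduction r g hg (algebraMap P _ (m : P)) =
        reduction r g hg (algebraMap P _ p) := by
      rw [← map_mul, IsLocalization.mk'_spec]
    have e2 := congrArg g₂ e
    rw [map_mul, reduction_algebraMap, reduction_algebraMap, ← h, ← h] at e2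
    rw [← e2]
    exact hx.mul hm
  have hp' : IsUnit (algebraMap P (CanonicalLift r g'') p) :=
    IsLocalization.map_units (CanonicalLift r g'') ⟨p, (mem_liftSubmonoid_iff r g'' p).mpr hp⟩
  have key : restrict r g g'' (liftSubmonoid_mono r g g'' g₂ h) (IsLocalization.mk' _ p m) *
      algebraMap P (CanonicalLift r g'') (m : P) = algebraMap P (CanonicalLift r g'') p := by
    rw [← restrict_algebraMap r g g'' (liftSubmonoid_mono r g g'' g₂ h) (m : P), ← map_mul, IsLocalization.mk'_spec,
      restrict_algebraMap]
  rw [← key] at hp'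
  exact isUnit_of_mul_isUnit_left hp'

/-- `L(r, g₂ ∘ g)`, as an `L(r, g)`-algebra through the canonical restriction, is the localisation of `L(r, g)` at `liftSubmonoid (red_{r,g}) g₂`
(Mathlib `IsLocalization.of_le` over ★ `isLocalization_map_restrict`). [cite: StacksProject, Tag 00CP] -/
theorem isLocalization_restrict_liftSubmonoid_reduction :
    @IsLocalization _ _ (liftSubmonoid (reduction r g hg) g₂) (CanonicalLift r g'') _
      (restrict r g g'' (liftSubmonoid_mono r g g'' g₂ h)).toRingHom.toAlgebra := by
  letI := (restrict r g g'' (liftSubmonoid_mono r g g'' g₂ h)).toRingHom.toAlgebra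
  haveI := isLocalization_map_restrict r g g'' (liftSubmonoid_mono r g g'' g₂ h)
  refine IsLocalization.of_le ((liftSubmonoid r g'').map (algebraMap P (CanonicalLift r g))) _ ?_ ?_
  · rintro _ ⟨p, hp, rfl⟩
    rw [SetLike.mem_coe, mem_liftSubmonoid_iff] at hp
    rw [mem_liftSubmonoid_iff, reduction_algebraMap, ← h]
    exact hp
  · intro x hx
    exact isUnit_restrict_of_mem_liftSubmonoid_reduction r g hg g₂ g'' h x hx

/-- **THE CANONICAL LIFT OF A CANONICAL LIFT IS THE CANONICAL LIFT:** `L(red_{r,g}, g₂) ≃ₐ[A'] L(r, g₂ ∘ g)`, the unique isomorphism over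
`L(r, g)` (so the restricted atlas' deeper chart rings ARE the old atlas' chart rings on the same opens): Mathlib `IsLocalization.algEquiv`
between two localisations of `L(r, g)` at `liftSubmonoid (red_{r,g}) g₂`, scalars restricted to `A'`.
[cite: StacksProject, Tag 00CP] [cite: Hartshorne2010, Thm. 10.2 (a) (proof), p. 81] [cite: Oort1971, Lemma (2.2.4) (p. 274)] -/
def liftOfLiftEquiv : CanonicalLift (reduction r g hg) g₂ ≃ₐ[A'] CanonicalLift r g'' :=
  letI : Algebra (CanonicalLift r g) (CanonicalLift r g'') := (restrict r g g'' (liftSubmonoid_mono r g g'' g₂ h)).toRingHom.toAlgebra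
  haveI : IsScalarTower A' (CanonicalLift r g) (CanonicalLift r g'') :=
    IsScalarTower.of_algebraMap_eq fun a => ((restrict r g g'' (liftSubmonoid_mono r g g'' g₂ h)).commutes a).symm
  haveI := isLocalization_restrict_liftSubmonoid_reduction r g hg g₂ g'' h
  (IsLocalization.algEquiv (liftSubmonoid (reduction r g hg) g₂) (CanonicalLift (reduction r g hg) g₂) (CanonicalLift r g'')).restrictScalars A'

/-- `liftOfLiftEquiv` is a map over `L(r, g)`: on `x/1` it is the canonical restriction. [cite: StacksProject, Tag 00CP] -/
theorem liftOfLiftEquiv_algebraMap (x : CanonicalLift r g) :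
    liftOfLiftEquiv r g hg g₂ g'' h (algebraMap (CanonicalLift r g) (CanonicalLift (reduction r g hg) g₂) x) =
      restrict r g g'' (liftSubmonoid_mono r g g'' g₂ h) x := by
  letI : Algebra (CanonicalLift r g) (CanonicalLift r g'') := (restrict r g g'' (liftSubmonoid_mono r g g'' g₂ h)).toRingHom.toAlgebra
  haveI : IsScalarTower A' (CanonicalLift r g) (CanonicalLift r g'') :=
    IsScalarTower.of_algebraMap_eq fun a => ((restrict r g g'' (liftSubmonoid_mono r g g'' g₂ h)).commutes a).symm
  haveI := isLocalization_restrict_liftSubmonoid_reduction r g hg g₂ g'' h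
  exact (IsLocalization.algEquiv (liftSubmonoid (reduction r g hg) g₂) (CanonicalLift (reduction r g hg) g₂) (CanonicalLift r g'')).commutes x

/-- **Uniqueness:** an `A'`-algebra map `L(red_{r,g}, g₂) → L(r, g₂ ∘ g)` over `L(r, g)` IS `liftOfLiftEquiv`. [cite: StacksProject, Tag 00CP] -/
theorem liftOfLiftEquiv_unique (e : CanonicalLift (reduction r g hg) g₂ →ₐ[A'] CanonicalLift r g'')
    (he : ∀ x : CanonicalLift r g, e (algebraMap _ _ x) = restrict r g g'' (liftSubmonoid_mono r g g'' g₂ h) x) :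
    e = (liftOfLiftEquiv r g hg g₂ g'' h : _ →ₐ[A'] _) :=
  algHom_ext_of_isLocalization (liftSubmonoid (reduction r g hg) g₂) e _ fun x => by
    rw [he, AlgEquiv.coe_toAlgHom, liftOfLiftEquiv_algebraMap]

/-- … equivalently for the inverse. [cite: StacksProject, Tag 00CP] -/
theorem liftOfLiftEquiv_symm_restrict (x : CanonicalLift r g) :
    (liftOfLiftEquiv r g hg g₂ g'' h).symm (restrict r g g'' (liftSubmonoid_mono r g g'' g₂ h) x) =
      algebraMap (CanonicalLift r g) (CanonicalLift (reduction r g hg) g₂) x := by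
  rw [AlgEquiv.symm_apply_eq, liftOfLiftEquiv_algebraMap]

/-- **Compatibility with the reductions:** `red_{r, g₂∘g} ∘ liftOfLiftEquiv = red_{red_{r,g}, g₂}`.
[cite: Hartshorne2010, Thm. 10.2 (a) (proof), p. 81] -/
theorem reduction_liftOfLiftEquiv [Algebra A' Q''] (hg'' : ∀ a, g'' (algebraMap A' Q a) = algebraMap A' Q'' a)
    (hg₂ : ∀ a, g₂ (algebraMap A' Q' a) = algebraMap A' Q'' a) (y : CanonicalLift (reduction r g hg) g₂) :
    reduction r g'' hg'' (liftOfLiftEquiv r g hg g₂ g'' h y) = reduction (reduction r g hg) g₂ hg₂ y := by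
  have key := algHom_ext_of_isLocalization (liftSubmonoid (reduction r g hg) g₂)
    ((reduction r g'' hg'').comp (liftOfLiftEquiv r g hg g₂ g'' h : _ →ₐ[A'] _)) (reduction (reduction r g hg) g₂ hg₂) fun x => by
      rw [AlgHom.comp_apply, AlgEquiv.coe_toAlgHom, liftOfLiftEquiv_algebraMap, reduction_algebraMap,
        reduction_restrict r g hg g'' hg'' g₂ h]
  exact congrArg (fun f : _ →ₐ[A'] _ => f y) key

/-- **Compatibility with further restriction:** for `g₃ = k ∘ g₂`, `g‴ = g₃ ∘ g` (any inclusion proofs `hle`, `hle′`), restricting after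
`liftOfLiftEquiv` is `liftOfLiftEquiv` after restricting (both are maps over `L(r, g)`). [cite: StacksProject, Tag 00CP] -/
theorem restrict_liftOfLiftEquiv (g₃ : Q' →+* Q''') (g''' : Q →+* Q''') (h₃ : ∀ q, g''' q = g₃ (g q))
    (hle : liftSubmonoid r g'' ≤ liftSubmonoid r g''') (hle' : liftSubmonoid (reduction r g hg) g₂ ≤ liftSubmonoid (reduction r g hg) g₃)
    (y : CanonicalLift (reduction r g hg) g₂) :
    restrict r g'' g''' hle (liftOfLiftEquiv r g hg g₂ g'' h y) =
      liftOfLiftEquiv r g hg g₃ g''' h₃ (restrict (reduction r g hg) g₂ g₃ hle' y) := by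
  have key := algHom_ext_of_isLocalization (liftSubmonoid (reduction r g hg) g₂)
    ((restrict r g'' g''' hle).comp (liftOfLiftEquiv r g hg g₂ g'' h : _ →ₐ[A'] _))
    ((liftOfLiftEquiv r g hg g₃ g''' h₃ : _ →ₐ[A'] _).comp (restrict (reduction r g hg) g₂ g₃ hle'))
    fun x => by
      rw [AlgHom.comp_apply, AlgHom.comp_apply, AlgEquiv.coe_toAlgHom, AlgEquiv.coe_toAlgHom, liftOfLiftEquiv_algebraMap,
        restrict_restrict, restrict_algebraMap, liftOfLiftEquiv_algebraMap]
  exact congrArg (fun f : _ →ₐ[A'] _ => f y) key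

end LiftOfLift

end Literature.AlgebraicGeometry.Deformation.CanonicalLiftQuot

end
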